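import Summits.RiemannHypothesis.RiemannHypothesis.Theorems.NymanBeurlingNbRateLogBurnol
import Literature.NumberTheory.LFunctions.RiemannHypothesisUpTo101

/-!
# RiemannHypothesis / NymanBeurling — crux #2 `NbRateLog`: a kernel-checked numerical floor `C > 0.214`

Route `RiemannHypothesis/NymanBeurling`, crux #2 `NbRateLog` (item stmt-RiemannHypothesis-0394):
`∃ C, ∀ N ≥ 2, ∃ a : Fin N → ℂ, ∫⁻ ‖1 - ζ(1/2+it) Σ_{k<N} a_k (k+1)^{-(1/2+it)}‖² dt/(1/4+t²) ≤ C/log N`.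

`Theorems/NymanBeurlingNbRateLogBurnol.lean` proves that every admissible `C` satisfies
`2π Σ_{ρ ∈ T} m_ρ²/|ρ|² ≤ C` for every finite set `T` of critical-line zeros (Burnol). This file

* upgrades the transfer to the EVENTUAL form of the hypothesis — only
  `∀ᶠ N, ∃ a, ∫⁻ … ≤ C/log N` is used, so the bounds below concern the asymptotic constant and not
  the cosmetic "one `C` for all `N ≥ 2`" (`two_pi_mul_le_of_eventually_nbRateBound`,
  `two_pi_mul_sum_multSq_le_of_eventually_nbRateBound`);
* extracts from the tree's kernel-checked certificate of the first `29` zeros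
  (`Literature/NumberTheory/LFunctions/RiemannHypothesisUpTo101.lean`: brackets
  `[a_j, a_j+24]/2⁸` around `γ₁ = 14.13…, …, γ₂₉ = 98.83…`) a finite set of `58` distinct zeros
  `1/2 ± iγ_j` with `Σ 1/|ρ|² ≥ 0.03407` (`exists_finset_zeros_sum_ge`);
* concludes: **every eventually admissible constant satisfies `0.214 < C`**
  (`lt_const_of_eventually_nbRateBound`, `lt_const_of_nbRateBound`, `nbRateLog_const_gt`).

For comparison, the Báez-Duarte–Balazard–Landreau–Saias conjecture predicts that the optimal
asymptotic constant is `2π Σ_ρ 1/|ρ|² = 2π(2 + γ - log 4π) = 0.29023…` [BDBLS2000;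
BettinConreyFarmer2013 §1]; the `29` certified zero pairs already force `74 %` of it.

References: J.-F. Burnol, Adv. Math. 170 (2002), Thm. 1.3; R. P. Brent, Math. Comp. 33 (1979) §3
(zeros on the line from sign changes); H. M. Edwards, Riemann's Zeta Function (1974) §6.6.
-/

noncomputable section

open Complex MeasureTheory Set Filter Topology
open scoped Real ENNReal ComplexConjugate

namespace Summit.RiemannHypothesis.RiemannHypothesis.Theorems

open Summit.RiemannHypothesis.RiemannHypothesis.Theses.NymanBeurling
open Literature.NumberTheory.LFunctions Literature.Barriers.RiemannHypothesis
open Literature.Analysis.ValidatedNumerics.NumericsMP Literature.NumberTheory.LFunctions.ZetaNumerics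
open Literature.NumberTheory.LFunctions.RHUpToCert

/-! ## 1. The transfer in eventual form -/

/-- **Transfer, eventual form.** If for every `ε > 0`, eventually as `λ → 0⁺`,
`(√A - ε)/√log(1/λ) ≤ D(λ)`, and `C` is EVENTUALLY admissible — for all large `N` some length-`N`
polynomial has `∫⁻ … ≤ C/log N` — then `2π A ≤ C`. Only one large `N` is used for each `ε`.
[cite: Burnol2002, Thm. 1.3] -/
theorem two_pi_mul_le_of_eventually_nbRateBound {A C : ℝ}
    (hA : ∀ ε : ℝ, 0 < ε → ∀ᶠ lam : ℝ in 𝓝[>] 0,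
      ENNReal.ofReal ((Real.sqrt A - ε) / Real.sqrt (Real.log (1 / lam))) ≤ nbDist lam)
    (hC : ∀ᶠ N : ℕ in atTop, ∃ a : Fin N → ℂ, ∫⁻ t : ℝ, ENNReal.ofReal (‖1 - riemannZeta (1 / 2 + t * Complex.I) *
        ∑ n : Fin N, a n * ((n : ℂ) + 1) ^ (-(1 / 2 + t * Complex.I))‖ ^ 2 / (1 / 4 + t ^ 2)) ≤
      ENNReal.ofReal (C / Real.log N)) :
    2 * π * A ≤ C := by
  -- `C > 0`: at one large `N` the bound meets the BDBLS floor `C₀ / log N`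
  have hCpos : 0 < C := by
    obtain ⟨C₀, hC₀, hfloor⟩ := nbIntegrand_lowerBound_two_le
    obtain ⟨N, hN2, a, ha⟩ := ((eventually_ge_atTop 2).and hC).exists
    have hlog : 0 < Real.log (N : ℝ) :=
      Real.log_pos (by exact_mod_cast Nat.lt_of_lt_of_le one_lt_two hN2)
    have h := (hfloor N hN2 a).trans ha
    by_contra hle
    push Not at hle
    have h0 : ENNReal.ofReal (C / Real.log N) = 0 :=
      ENNReal.ofReal_of_nonpos (div_nonpos_of_nonpos_of_nonneg hle hlog.le)
    rw [h0, nonpos_iff_eq_zero, ENNReal.ofReal_eq_zero] at h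
    exact absurd h (not_le.2 (div_pos hC₀ hlog))
  by_cases hA0 : A ≤ 0
  · nlinarith [Real.pi_pos]
  push Not at hA0
  have key : ∀ ε : ℝ, 0 < ε → ε < Real.sqrt A → 2 * π * (Real.sqrt A - ε) ^ 2 ≤ C := by
    intro ε hε hεA
    have ht : 0 < Real.sqrt A - ε := by linarith
    have hlam : Tendsto (fun N : ℕ ↦ (N : ℝ)⁻¹) atTop (𝓝[>] 0) :=
      tendsto_inv_atTop_nhdsGT_zero.comp tendsto_natCast_atTop_atTop
    obtain ⟨N, ⟨hN2, hN⟩, a, ha⟩ :=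
      (((eventually_ge_atTop 2).and (hlam.eventually (hA ε hε))).and hC).exists
    rw [one_div, inv_inv] at hN
    have hlog : 0 < Real.log (N : ℝ) :=
      Real.log_pos (by exact_mod_cast Nat.lt_of_lt_of_le one_lt_two hN2)
    have e : ENNReal.ofReal (2 * π) *
        ENNReal.ofReal ((Real.sqrt A - ε) / Real.sqrt (Real.log N)) ^ 2 =
          ENNReal.ofReal (2 * π * ((Real.sqrt A - ε) ^ 2 / Real.log N)) := by
      rw [← ENNReal.ofReal_pow (div_nonneg ht.le (Real.sqrt_nonneg _)), div_pow,
        Real.sq_sqrt hlog.le, ← ENNReal.ofReal_mul (by positivity)]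
    have h1 : ENNReal.ofReal (2 * π * ((Real.sqrt A - ε) ^ 2 / Real.log N)) ≤
        ENNReal.ofReal (C / Real.log N) :=
      calc ENNReal.ofReal (2 * π * ((Real.sqrt A - ε) ^ 2 / Real.log N))
          = ENNReal.ofReal (2 * π) *
              ENNReal.ofReal ((Real.sqrt A - ε) / Real.sqrt (Real.log N)) ^ 2 := e.symm
        _ ≤ ENNReal.ofReal (2 * π) * nbDist ((N : ℝ)⁻¹) ^ 2 := by gcongr
        _ ≤ _ := two_pi_mul_nbDist_sq_le N a
        _ ≤ ENNReal.ofReal (C / Real.log N) := ha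
    rw [ENNReal.ofReal_le_ofReal_iff (div_nonneg hCpos.le hlog.le), mul_div_assoc',
      div_le_div_iff_of_pos_right hlog] at h1
    exact h1
  have hlim : Tendsto (fun ε : ℝ ↦ 2 * π * (Real.sqrt A - ε) ^ 2) (𝓝[>] 0)
      (𝓝 (2 * π * (Real.sqrt A - 0) ^ 2)) :=
    ((continuous_const.mul ((continuous_const.sub continuous_id).pow 2)).tendsto 0).mono_left
      nhdsWithin_le_nhds
  rw [sub_zero, Real.sq_sqrt hA0.le] at hlim
  refine le_of_tendsto hlim ?_
  filter_upwards [Ioo_mem_nhdsGT (Real.sqrt_pos.2 hA0)] with ε hε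
  exact key ε hε.1 hε.2

/-- **Finite-family bound, eventual form.** If `C` is eventually admissible then
`2π Σ_{ρ ∈ T} m_ρ²/|ρ|² ≤ C` for every finite set `T` of zeros of `ζ` on the critical line.
[cite: Burnol2002, Thm. 1.3 and Thm. 5.4] -/
theorem two_pi_mul_sum_multSq_le_of_eventually_nbRateBound {C : ℝ}
    (hC : ∀ᶠ N : ℕ in atTop, ∃ a : Fin N → ℂ, ∫⁻ t : ℝ, ENNReal.ofReal (‖1 - riemannZeta (1 / 2 + t * Complex.I) *
        ∑ n : Fin N, a n * ((n : ℂ) + 1) ^ (-(1 / 2 + t * Complex.I))‖ ^ 2 / (1 / 4 + t ^ 2)) ≤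
      ENNReal.ofReal (C / Real.log N))
    (T : Finset ℂ) (hT : ∀ ρ ∈ T, riemannZeta ρ = 0 ∧ ρ.re = 1 / 2) :
    2 * π * ∑ ρ ∈ T, (riemannZetaZeroOrder ρ : ℝ) ^ 2 / ‖ρ‖ ^ 2 ≤ C :=
  two_pi_mul_le_of_eventually_nbRateBound
    (fun _ hε ↦ Burnol2002Assembly.eventually_nbDist_ge_of_finset T hT hε) hC

/-! ## 2. Zeros out of the tree's bracket certificate -/

/-- Concatenation of checked bracket lists: a list checked above `h` followed by a list checked
above its last end point is checked above `h`. [folklore] -/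
theorem checkBrackets_append (T : Tables) :
    ∀ (h : ℕ) (L₁ L₂ : List (ℕ × ℕ)), checkBrackets T h L₁ = true →
      checkBrackets T (lastB h L₁) L₂ = true → checkBrackets T h (L₁ ++ L₂) = true
  | h, [], L₂, _, h₂ => by simpa [lastB] using h₂
  | h, (a, b) :: L₁, L₂, h₁, h₂ => by
    simp only [checkBrackets, Bool.and_eq_true, decide_eq_true_eq] at h₁
    obtain ⟨⟨hha, hB⟩, hrest⟩ := h₁
    simp only [List.cons_append, checkBrackets, Bool.and_eq_true, decide_eq_true_eq]
    exact ⟨⟨hha, hB⟩, checkBrackets_append T b L₁ L₂ hrest (by simpa [lastB] using h₂)⟩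

/-- Concatenation for `checkZeros`. [folklore] -/
theorem checkZeros_append {N nu h : ℕ} {L₁ L₂ : List (ℕ × ℕ)}
    (h₁ : checkZeros N nu h L₁ = true) (h₂ : checkZeros N nu (lastB h L₁) L₂ = true) :
    checkZeros N nu h (L₁ ++ L₂) = true := by
  unfold checkZeros at h₁ h₂ ⊢
  generalize hTab : tablesWith N nu = o at h₁ h₂ ⊢
  rcases o with _ | T
  · simp at h₁
  · simp only at h₁ h₂ ⊢
    exact checkBrackets_append T h L₁ L₂ h₁ h₂

/-- **Distinct certified zeros and their `Σ 1/|ρ|²`.** A bracket list checked above `h` yields a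
finite set of zeros `ρ = 1/2 + iγ` of `ζ` on the critical line with `Im ρ > h/2⁸`, one in each
bracket `[a/2⁸, b/2⁸]`, whose `Σ 1/|ρ|²` is at least `Σ_{(a,b)} 1/(1/4 + (b/2⁸)²)`
(`|ρ|² = 1/4 + γ² ≤ 1/4 + (b/2⁸)²`; the brackets are separated, so the zeros are distinct).
[cite: Brent1979, §3] -/
theorem exists_finset_of_checkBrackets {T : Tables} (hT : T.Valid) (hTS : T.S = S) :
    ∀ (h : ℕ) (L : List (ℕ × ℕ)), checkBrackets T h L = true →
      ∃ F : Finset ℂ, (∀ ρ ∈ F, riemannZeta ρ = 0 ∧ ρ.re = 1 / 2 ∧ (h : ℝ) / 256 < ρ.im) ∧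
        (L.map fun p : ℕ × ℕ ↦ (1 : ℝ) / (1 / 4 + ((p.2 : ℝ) / 256) ^ 2)).sum ≤
          ∑ ρ ∈ F, 1 / ‖ρ‖ ^ 2
  | h, [], _ => ⟨∅, by simp, by simp⟩
  | h, (a, b) :: L, hok => by
    simp only [checkBrackets, Bool.and_eq_true, decide_eq_true_eq] at hok
    obtain ⟨⟨hha, hB⟩, hrest⟩ := hok
    obtain ⟨ha1, hab, γ, hγ, hz⟩ := exists_zero_of_checkBracket hT hTS hB
    obtain ⟨F, hF, hsum⟩ := exists_finset_of_checkBrackets hT hTS b L hrest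
    have hha' : (h : ℝ) / 256 < (a : ℝ) / 256 :=
      div_lt_div_of_pos_right (by exact_mod_cast hha) (by norm_num)
    have hρim : ((1 / 2 : ℂ) + γ * I).im = γ := by simp
    have hρre : ((1 / 2 : ℂ) + γ * I).re = 1 / 2 := by simp
    have hρF : (1 / 2 : ℂ) + γ * I ∉ F := fun hmem ↦ by
      have h3 := (hF _ hmem).2.2
      rw [hρim] at h3
      linarith [hγ.2]
    refine ⟨insert ((1 / 2 : ℂ) + γ * I) F, ?_, ?_⟩
    · intro ρ' hρ'
      rcases Finset.mem_insert.1 hρ' with rfl | hmem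
      · exact ⟨hz, hρre, by rw [hρim]; linarith [hγ.1]⟩
      · obtain ⟨h1, h2, h3⟩ := hF ρ' hmem
        exact ⟨h1, h2, lt_trans (by linarith) h3⟩
    · rw [List.map_cons, List.sum_cons, Finset.sum_insert hρF]
      refine add_le_add ?_ hsum
      have hγ0 : 0 ≤ γ := le_trans (by positivity) (ha1.trans hγ.1)
      rw [norm_sq_one_half_add γ]
      exact one_div_le_one_div_of_le (by positivity) (by nlinarith [hγ.2])

/-- The same from a `checkZeros` verdict (tables built by `tablesWith`). [cite: Brent1979, §3] -/
theorem exists_finset_of_checkZeros {N nu h : ℕ} {L : List (ℕ × ℕ)}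
    (hc : checkZeros N nu h L = true) :
    ∃ F : Finset ℂ, (∀ ρ ∈ F, riemannZeta ρ = 0 ∧ ρ.re = 1 / 2 ∧ (h : ℝ) / 256 < ρ.im) ∧
      (L.map fun p : ℕ × ℕ ↦ (1 : ℝ) / (1 / 4 + ((p.2 : ℝ) / 256) ^ 2)).sum ≤
        ∑ ρ ∈ F, 1 / ‖ρ‖ ^ 2 := by
  unfold checkZeros at hc
  generalize hTab : tablesWith N nu = o at hc
  rcases o with _ | T
  · simp at hc
  · simp only at hc
    exact exists_finset_of_checkBrackets (tablesWith_valid hTab) (tablesWith_S hTab) h L hc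

/-- **The `29` certified zero pairs.** There is a finite set of zeros of `ζ` on the critical line
(the `29` zeros `1/2 + iγ_j`, `γ₁ = 14.13…, …, γ₂₉ = 98.83…` bracketed in
`Literature/NumberTheory/LFunctions/RiemannHypothesisUpTo101.lean`, and their conjugates) with
`Σ 1/|ρ|² ≥ 0.03407` and hence `Σ m_ρ²/|ρ|² ≥ 0.03407`. (The full sum over all zeros is
`2 + γ - log 4π = 0.046191…` under RH [BettinConreyFarmer2013, §1].) [cite: Brent1979, §3] -/
theorem exists_finset_zeros_sum_ge : ∃ G : Finset ℂ, (∀ ρ ∈ G, riemannZeta ρ = 0 ∧ ρ.re = 1 / 2) ∧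
    (3407 : ℝ) / 100000 ≤ ∑ ρ ∈ G, (riemannZetaZeroOrder ρ : ℝ) ^ 2 / ‖ρ‖ ^ 2 := by
  classical
  -- the six bracket groups as one checked list above height `0`
  have hc := checkZeros_append (checkZeros_append (checkZeros_append (checkZeros_append
    (checkZeros_append RH101.checkZeros₁ RH101.checkZeros₂) RH101.checkZeros₃) RH101.checkZeros₄)
    RH101.checkZeros₅) RH101.checkZeros₆
  obtain ⟨F, hF, hsum⟩ := exists_finset_of_checkZeros hc
  -- the bracket sum, evaluated
  have hval : (17035 : ℝ) / 1000000 ≤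
      (([(3606, 3630), (5370, 5394), (6391, 6415), (7777, 7801), (8419, 8443)] ++
        [(9610, 9634), (10463, 10487), (11080, 11104), (12277, 12301), (12730, 12754)] ++
        [(13548, 13572), (14438, 14462), (15181, 15205), (15561, 15585), (16657, 16681)] ++
        [(17160, 17184), (17792, 17816), (18437, 18461), (19368, 19392), (19737, 19761)] ++
        [(20298, 20322), (21213, 21237), (21680, 21704), (22369, 22393), (22723, 22747)] ++
        [(23666, 23690), (24219, 24243), (24531, 24555), (25289, 25313)]).map
        fun p : ℕ × ℕ ↦ (1 : ℝ) / (1 / 4 + ((p.2 : ℝ) / 256) ^ 2)).sum := by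
    simp only [List.cons_append, List.nil_append, List.map_cons, List.map_nil, List.sum_cons,
      List.sum_nil]
    norm_num
  have hF' : (17035 : ℝ) / 1000000 ≤ ∑ ρ ∈ F, 1 / ‖ρ‖ ^ 2 := hval.trans hsum
  -- add the conjugate zeros
  have hFpos : ∀ ρ ∈ F, 0 < ρ.im := fun ρ hρ ↦ by
    have := (hF ρ hρ).2.2; simp at this; exact this
  have hdisj : Disjoint F (F.image conj) := by
    rw [Finset.disjoint_left]
    intro ρ hρ hρ'
    obtain ⟨ρ₀, hρ₀, rfl⟩ := Finset.mem_image.1 hρ'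
    have h1 := hFpos _ hρ
    have h2 := hFpos _ hρ₀
    rw [Complex.conj_im] at h1
    linarith
  refine ⟨F ∪ F.image conj, fun ρ hρ ↦ ?_, ?_⟩
  · rcases Finset.mem_union.1 hρ with h | h
    · exact ⟨(hF ρ h).1, (hF ρ h).2.1⟩
    · obtain ⟨ρ₀, hρ₀, rfl⟩ := Finset.mem_image.1 h
      refine ⟨?_, by rw [Complex.conj_re]; exact (hF ρ₀ hρ₀).2.1⟩
      rw [riemannZeta_conj, (hF ρ₀ hρ₀).1, map_zero]
  · -- every listed point is a zero `≠ 1`, so `m_ρ ≥ 1` and `m_ρ²/|ρ|² ≥ 1/|ρ|²`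
    have hm : ∀ ρ : ℂ, riemannZeta ρ = 0 → ρ.re = 1 / 2 →
        1 / ‖ρ‖ ^ 2 ≤ (riemannZetaZeroOrder ρ : ℝ) ^ 2 / ‖ρ‖ ^ 2 := by
      intro ρ hz hre
      have hne : ρ ≠ 1 := fun h ↦ by norm_num [h] at hre
      have h1 : (1 : ℤ) ≤ riemannZetaZeroOrder ρ := (riemannZetaZeroOrder_pos_iff hne).2 hz
      have h1' : (1 : ℝ) ≤ (riemannZetaZeroOrder ρ : ℝ) := by exact_mod_cast h1
      exact div_le_div_of_nonneg_right (by nlinarith) (by positivity)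
    have hsumG : ∑ ρ ∈ F ∪ F.image conj, 1 / ‖ρ‖ ^ 2 = 2 * ∑ ρ ∈ F, 1 / ‖ρ‖ ^ 2 := by
      rw [Finset.sum_union hdisj, Finset.sum_image fun x _ y _ h ↦ (starRingEnd ℂ).injective h]
      simp only [Complex.norm_conj]
      ring
    calc (3407 : ℝ) / 100000 ≤ 2 * ∑ ρ ∈ F, 1 / ‖ρ‖ ^ 2 := by linarith
      _ = ∑ ρ ∈ F ∪ F.image conj, 1 / ‖ρ‖ ^ 2 := hsumG.symm
      _ ≤ _ := Finset.sum_le_sum fun ρ hρ ↦ by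
          rcases Finset.mem_union.1 hρ with h | h
          · exact hm ρ (hF ρ h).1 (hF ρ h).2.1
          · obtain ⟨ρ₀, hρ₀, rfl⟩ := Finset.mem_image.1 h
            refine hm _ ?_ (by rw [Complex.conj_re]; exact (hF ρ₀ hρ₀).2.1)
            rw [riemannZeta_conj, (hF ρ₀ hρ₀).1, map_zero]

/-! ## 3. The numerical floor -/

/-- **Every eventually admissible constant exceeds `0.214`.** If for all large `N` some length-`N`
Dirichlet polynomial achieves `∫⁻ ‖1 - ζA‖²/(1/4+t²) ≤ C/log N`, then `0.214 < C`: Burnol's bound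
over the `58` certified zeros `1/2 ± iγ_j`, `j ≤ 29`, gives `C ≥ 2π · 0.03407 > 0.214`. The BDBLS
conjecture predicts the optimal asymptotic constant `2π(2 + γ - log 4π) = 0.29023…`.
[cite: Burnol2002, Thm. 1.3] [cite: BDBLS2000, conjecture] -/
theorem lt_const_of_eventually_nbRateBound {C : ℝ}
    (hC : ∀ᶠ N : ℕ in atTop, ∃ a : Fin N → ℂ, ∫⁻ t : ℝ, ENNReal.ofReal (‖1 - riemannZeta (1 / 2 + t * Complex.I) *
        ∑ n : Fin N, a n * ((n : ℂ) + 1) ^ (-(1 / 2 + t * Complex.I))‖ ^ 2 / (1 / 4 + t ^ 2)) ≤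
      ENNReal.ofReal (C / Real.log N)) :
    (214 : ℝ) / 1000 < C := by
  obtain ⟨G, hG, hsum⟩ := exists_finset_zeros_sum_ge
  have h := two_pi_mul_sum_multSq_le_of_eventually_nbRateBound hC G hG
  nlinarith [Real.pi_gt_d6, hsum, h]

/-- **Every admissible constant of crux #2 exceeds `0.214`** (the `∀ N ≥ 2` form of the item).
[cite: Burnol2002, Thm. 1.3] -/
theorem lt_const_of_nbRateBound {C : ℝ}
    (hC : ∀ N : ℕ, 2 ≤ N → ∃ a : Fin N → ℂ, ∫⁻ t : ℝ, ENNReal.ofReal (‖1 - riemannZeta (1 / 2 + t * Complex.I) *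
        ∑ n : Fin N, a n * ((n : ℂ) + 1) ^ (-(1 / 2 + t * Complex.I))‖ ^ 2 / (1 / 4 + t ^ 2)) ≤
      ENNReal.ofReal (C / Real.log N)) :
    (214 : ℝ) / 1000 < C :=
  lt_const_of_eventually_nbRateBound ((eventually_ge_atTop 2).mono fun N hN ↦ hC N hN)

/-- **`NbRateLog` can only hold with `C > 0.214`.** [cite: Burnol2002, Thm. 1.3] -/
theorem nbRateLog_const_gt :
    NbRateLog ↔ ∃ C : ℝ, (214 : ℝ) / 1000 < C ∧ ∀ N : ℕ, 2 ≤ N → ∃ a : Fin N → ℂ,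
      ∫⁻ t : ℝ, ENNReal.ofReal (‖1 - riemannZeta (1 / 2 + t * Complex.I) *
        ∑ n : Fin N, a n * ((n : ℂ) + 1) ^ (-(1 / 2 + t * Complex.I))‖ ^ 2 / (1 / 4 + t ^ 2)) ≤
      ENNReal.ofReal (C / Real.log N) := by
  unfold NbRateLog
  exact ⟨fun ⟨C, hC⟩ ↦ ⟨C, lt_const_of_nbRateBound hC, hC⟩, fun ⟨C, _, hC⟩ ↦ ⟨C, hC⟩⟩

end Summit.RiemannHypothesis.RiemannHypothesis.Theorems

end
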